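import Mathlib
import Summits.NavierStokesRegularity.NavierStokesRegularity.Theorems.EulerZoomLiouvillePowerGaugeEulerLiouvilleHoopRunContradiction
import Summits.NavierStokesRegularity.NavierStokesRegularity.Theorems.EulerZoomLiouvillePowerGaugeEulerLiouvilleHoopRunDefs
import Summits.NavierStokesRegularity.NavierStokesRegularity.Theorems.EulerZoomLiouvillePowerGaugeEulerLiouvilleLastExitCriticalSpikes
import HarnessLib

/-!
# «NO LONG STRAIGHT SLOW ∧ HIGH RUNS» — THE K-TJ′ MEMBER (hoop line; `IsKinematicTameProfile` alternative-8 candidate)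

Crux `EulerZoomLiouville.PowerGaugeEulerLiouville` = stmt-NavierStokesRegularity-19832 (a crux CLASS of self-similar Euler/NS strata
on the MODEL lattice — not NS regularity, not E).  Width seat ns-ezl-w3 g7 (K-TJ′-PROOF file (M); LEAD 19832 ns-typeII-p2 g14 key
03:09:57Z/03:24:52Z; face `HasStraightSlowHighRuns` = nsreg-p2 g39's K-TJ′ TEXT, landed by the LEAD as `…HoopRunDefs`;
constants checked by ns-idea-11 g9), `--supports stmt-NavierStokesRegularity-19832 --as helper`.

`Loc.selfSimilar_ae_eq_zero_of_straightSlowHighRunsC2_profile` — binders EXACTLY those of `StraightSlowHighRunsMember` (K-SPIKE shape):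
an exactly self-similar member of the crux class (`0 < ρ ≤ ½`, crux hypotheses verbatim) with a `C²` velocity profile that has, for
every classical profile pressure, STRAIGHT, THIN (`b = R^{−(1+ρ)}`), QUIET-WALLED, SLOW ∧ BERNOULLI-HIGH RUNS of length `≥ Λ·b` arbitrarily
far out — with the face's explicit constraint `(1−ρ)c/(2+ρ) + 4K² + 4K < Λ(½γ(1−γ) − ½λ² − η − ν²)` — is trivial.
Proof: classical pressure `P′` for the profile (`WeakToClassical`), the profile E-budget `∫⁻_{B̄_L}‖DV‖ₑ² ≤ (1−ρ)c/(2+ρ)·L^{1−ρ}`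
(`NeedleThinCore.selfSimilar_needle_inputs` + `NeedleRace.lintegral_fderiv_sq_closedBall_le`), the face's constants, `R₀` chosen so that the
error `Λ(K/2 + γν)R^{−(2+ρ)}` is below half the margin, one run beyond `R₀`, and `HoopCore.false_of_straightSlowHighRun` (M0: TJ-CORE =
AX∫ + transverse hoop inequality on the moved cylinder).  Only the (E)-gauge of the class is consumed.

HONEST FRAME / WHAT THIS IS NOT: a member-level stratum — it kills ONLY the «straight, thin, quiet-walled slow∧high run ≥ Λ(ρ,c,K,…)·b»
face of the needle (kinked chains of b-cells, fat ridges, noisy walls, kinetically-high spines, Bernoulli spikes are untouched); not NS,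
not E; 19832 OPEN; NS regularity NOT proved.  [nsreg-p2 g39 K-TJ′ TEXT; ns-idea-11 g8 HOOP NOTE §4–§6, §8, §10; ConstantinIgnatovaVicol2026Putative §3]
-/

noncomputable section

set_option linter.dupNamespace false

open Set Filter Topology Metric MeasureTheory Function
open scoped RealInnerProductSpace ENNReal NNReal

namespace Summit.NavierStokesRegularity.NavierStokesRegularity.Theorems.PowerGaugeEulerLiouville

open Literature.Analysis Literature.Analysis.FluidPDE

/-- **«NO LONG STRAIGHT SLOW ∧ HIGH RUNS» MEMBER (centred; K-TJ′).**  An exactly self-similar member of the crux class (`0 < ρ ≤ ½`, crux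
hypotheses verbatim) with a `C²` velocity profile satisfying `HasStraightSlowHighRuns ρ c V` is trivial.  Binders = `StraightSlowHighRunsMember`.
[nsreg-p2 g39 K-TJ′ TEXT; ns-idea-11 g8 HOOP NOTE §4, §8(b), §10(a)] -/
theorem Loc.selfSimilar_ae_eq_zero_of_straightSlowHighRunsC2_profile {ρ : ℝ} (hρ : 0 < ρ) (hρ1 : ρ ≤ 1 / 2)
    {u : ℝ → EuclideanSpace ℝ (Fin 3) → EuclideanSpace ℝ (Fin 3)} {p : ℝ → EuclideanSpace ℝ (Fin 3) → ℝ}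
    {H : ℝ → EuclideanSpace ℝ (Fin 3) → EuclideanSpace ℝ (Fin 3) →L[ℝ] EuclideanSpace ℝ (Fin 3)} {c : ℝ≥0}
    (hsw : IsSuitableWeakSolutionOn (slab (EuclideanSpace ℝ (Fin 3)) (Iio 0) isOpen_Iio) 0 0 u p)
    (hH : HasWeakSpatialGradientOn (slab (EuclideanSpace ℝ (Fin 3)) (Iio 0) isOpen_Iio) u H)
    (hgauge : ∀ a : ℝ, 0 < a →
      ENNReal.ofReal (a ^ (2 * ρ)) * cknA a (0 : ℝ × EuclideanSpace ℝ (Fin 3)) u +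
          ENNReal.ofReal (a ^ ρ) * cknE a (0 : ℝ × EuclideanSpace ℝ (Fin 3)) H +
        ENNReal.ofReal (a ^ (2 * ρ)) * cknD a (0 : ℝ × EuclideanSpace ℝ (Fin 3)) p ≤ (c : ℝ≥0∞))
    {V : EuclideanSpace ℝ (Fin 3) → EuclideanSpace ℝ (Fin 3)} {P : EuclideanSpace ℝ (Fin 3) → ℝ}
    (hu : ∀ τ : ℝ, τ < 0 → u τ = selfSimilarCollapse (1 / (2 + ρ)) 0 V τ)
    (hp : ∀ τ : ℝ, τ < 0 → p τ = selfSimilarCollapsePressure (1 / (2 + ρ)) 0 P τ)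
    (hV : ContDiff ℝ 2 V)
    (hQ : HasStraightSlowHighRuns ρ c V) :
    uncurry u =ᵐ[volume.restrict (Iio (0 : ℝ) ×ˢ (univ : Set (EuclideanSpace ℝ (Fin 3))))] 0 := by
  have hρ1' : ρ < 1 := by linarith
  have h2ρ : (0 : ℝ) < 2 + ρ := by linarith
  have h1ρ : 0 ≤ 1 - ρ := by linarith
  -- ### a classical pressure for the profile (as in K-SPIKE)
  have hD : ∀ a : ℝ, 0 < a → ENNReal.ofReal (a ^ (2 * ρ)) *
      cknD a (0 : ℝ × EuclideanSpace ℝ (Fin 3)) p ≤ (c : ℝ≥0∞) :=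
    fun a ha => le_trans le_add_self (hgauge a ha)
  have hpm : AEStronglyMeasurable (uncurry p)
      (volume.restrict (Iio (0 : ℝ) ×ˢ (univ : Set (EuclideanSpace ℝ (Fin 3))))) := by
    have := hsw.distributional.2.2.1.aestronglyMeasurable
    simpa [slab] using this
  have hPm := aestronglyMeasurable_pressureProfile hpm hp
  have hDprof := profile_pressure_weight_of_gaugeD hρ hρ1' hpm hp hD
  have hP1 : LocallyIntegrable P volume :=
    EnergySaturation.locallyIntegrable_pressure_of_weight hρ1' hPm
      (ENNReal.mul_ne_top ENNReal.ofReal_ne_top ENNReal.coe_ne_top) hDprof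
  obtain ⟨P', hprof⟩ :=
    WeakToClassical.exists_isSelfSimilarEulerProfile_of_contDiff hsw.distributional hu hp hV hP1
  -- ### the profile E-budget on closed balls
  obtain ⟨-, hE'⟩ :=
    NeedleThinCore.selfSimilar_needle_inputs hρ hρ1' hsw hH hgauge hu hp (hV.of_le one_le_two)
  have hE0 : 0 ≤ (1 - ρ) / (2 + ρ) * (c : ℝ) := by positivity
  have hbE : ∀ L : ℝ, 1 ≤ L →
      ∫⁻ z in closedBall (0 : EuclideanSpace ℝ (Fin 3)) L, ‖fderiv ℝ V z‖ₑ ^ 2 ≤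
        ENNReal.ofReal ((1 - ρ) / (2 + ρ) * (c : ℝ) * L ^ (1 - ρ)) :=
    fun L hL => NeedleRace.lintegral_fderiv_sq_closedBall_le hρ1' hE0 hE' hL
  -- ### the face: constants, margin, a radius beyond which the error is below half the margin, one run
  obtain ⟨Λ, lam, η, ν, K, hΛ, -, -, hν, hK, hface, hrun⟩ := hQ P' hprof
  have hB0 : 0 ≤ (1 - ρ) * (c : ℝ) / (2 + ρ) := by positivity
  set δ : ℝ := Λ * ((1 / (2 + ρ)) * (1 - 1 / (2 + ρ)) / 2 - lam ^ 2 / 2 - η - ν ^ 2)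
    - ((1 - ρ) * (c : ℝ) / (2 + ρ) + 4 * K ^ 2 + 4 * K) with hδdef
  have hδ : 0 < δ := by rw [hδdef]; linarith
  set M : ℝ := Λ * (K / 2 + (1 / (2 + ρ)) * ν) with hMdef
  have hM0 : 0 ≤ M := by rw [hMdef]; positivity
  obtain ⟨A, a, R, s₁, s₂, h, hR₀R, hR1, hlen, htube, haxis⟩ := hrun (max 1 (2 * M / δ))
  have hR0 : 0 < R := by linarith
  have hsmall : Λ * ((K / 2 + (1 / (2 + ρ)) * ν) * R ^ (-(2 + ρ))) ≤ δ / 2 := by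
    have h1 : R ^ (-(2 + ρ)) ≤ R ^ (-(1 : ℝ)) := Real.rpow_le_rpow_of_exponent_le hR1 (by linarith)
    have h2 : R ^ (-(1 : ℝ)) = 1 / R := by rw [Real.rpow_neg hR0.le, Real.rpow_one, one_div]
    have h3 : Λ * ((K / 2 + (1 / (2 + ρ)) * ν) * R ^ (-(2 + ρ))) ≤ M * (1 / R) := by
      rw [hMdef, mul_assoc]
      exact mul_le_mul_of_nonneg_left (mul_le_mul_of_nonneg_left (h1.trans h2.le) (by positivity)) hΛ.le
    have h4 : 2 * M / δ ≤ R := le_trans (le_max_right _ _) hR₀R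
    have h5 : M * (1 / R) ≤ δ / 2 := by
      rw [mul_one_div, div_le_div_iff₀ hR0 two_pos]
      rw [div_le_iff₀ hδ] at h4
      linarith
    exact h3.trans h5
  have hER : ∫⁻ z in closedBall (0 : EuclideanSpace ℝ (Fin 3)) (2 * R), ‖fderiv ℝ V z‖ₑ ^ 2 ≤
      ENNReal.ofReal ((1 - ρ) * (c : ℝ) / (2 + ρ) * (2 * R) ^ (1 - ρ)) := by
    have e : (1 - ρ) / (2 + ρ) * (c : ℝ) * (2 * R) ^ (1 - ρ) = (1 - ρ) * (c : ℝ) / (2 + ρ) * (2 * R) ^ (1 - ρ) := by ring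
    rw [← e]
    exact hbE (2 * R) (by linarith)
  have hsmall' : Λ * ((K / 2 + (1 / (2 + ρ)) * ν) * R ^ (-(2 + ρ))) ≤
      (Λ * ((1 / (2 + ρ)) * (1 - 1 / (2 + ρ)) / 2 - lam ^ 2 / 2 - η - ν ^ 2)
        - ((1 - ρ) * (c : ℝ) / (2 + ρ) + 4 * K ^ 2 + 4 * K)) / 2 := by
    rw [← hδdef]; exact hsmall
  exact (HoopCore.false_of_straightSlowHighRun hρ hρ1 hprof hΛ hν hK hB0 hface hR1 hlen htube haxis hER hsmall').elim

end Summit.NavierStokesRegularity.NavierStokesRegularity.Theorems.PowerGaugeEulerLiouville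

end
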